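import Literature.NumberTheory.QuadraticForms.HilbertSymbol
import Literature.NumberTheory.Automorphic.QuaternionAlgebraSplitting
import HarnessLib

/-!
# The Hilbert symbol and the splitting of `ℍ[F,a,b]`: discharge of O'Meara 57:9

Proof file next to `Literature.NumberTheory.QuadraticForms.HilbertSymbol` (topic
`NumberTheory/QuadraticForms`, namespace `Literature`), all declarations fully proved:

* `exists_sq_sub_mul_sq_iff_hilbertSymbol_eq_one` : for `a b ≠ 0` in a field with `2 ≠ 0`,
  `X² - a Y² = b` is soluble iff `a x² + b y² = 1` is soluble, i.e. iff `(a, b)_F = 1`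
  (the two classical descriptions of "`b` is a norm from `F(√a)`, or `a` is a square";
  O'Meara §63B, 63:10);
* `QuaternionAlgebra.nonempty_algEquiv_matrix_iff_hilbertSymbol_eq_one_holds` : **discharge** of
  the named fact `QuaternionAlgebra.nonempty_algEquiv_matrix_iff_hilbertSymbol_eq_one`
  (O'Meara 57:9: `ℍ[F,a,b] ≅ M₂(F)` iff `(a, b)_F = 1`), from the splitting criterion
  `Literature.NumberTheory.Automorphic.QuaternionAlgebra.nonempty_algEquiv_matrix_iff` proved in
  `Literature/NumberTheory/Automorphic/QuaternionAlgebraSplitting.lean` (Vignéras I Cor. 2.4: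
  `ℍ[F,a,b] ≅ M₂(F)` iff `X² - a Y² = b` is soluble).

## References

* O. T. O'Meara, *Introduction to quadratic forms*, Grundlehren 117, Springer (1963), §57
  Prop. 57:9, §63B.
* M.-F. Vignéras, *Arithmétique des algèbres de quaternions*, LNM 800 (1980), Ch. I §2 Cor. 2.4.
-/

noncomputable section

open scoped Quaternion

namespace Literature.NumberTheory.QuadraticForms

/-- Over a field with `2 ≠ 0`, for `a b ≠ 0`: `b` is represented by the binary form `X² - a Y²`
iff `a x² + b y² = 1` is soluble, i.e. iff the Hilbert symbol `(a, b)_F` is `1`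
(O'Meara §63B with 63:10 / 57:9: both say `b ∈ N(F(√a))` or `a` is a square). Explicit
witnesses: `X² - aY² = b`, `X ≠ 0` gives `a (Y/X)² + b (1/X)² = 1`; `X = 0` makes `-b/a` a
square and `x² - z² = 1/a` is soluble; conversely `a x² + b y² = 1`, `y ≠ 0` gives
`(1/y)² - a (x/y)² = b`, and `y = 0` makes `a` a square, when `X² - aY²` is universal. [folklore] -/
theorem exists_sq_sub_mul_sq_iff_hilbertSymbol_eq_one {F : Type*} [Field F] [NeZero (2 : F)]
    {a b : F} (ha : a ≠ 0) (hb : b ≠ 0) :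
    (∃ x y : F, x ^ 2 - a * y ^ 2 = b) ↔ hilbertSymbol F a b = 1 := by
  have h2 : (2 : F) ≠ 0 := two_ne_zero
  rw [hilbertSymbol_eq_one_iff]
  constructor
  · rintro ⟨X, Y, h⟩
    by_cases hX : X = 0
    · subst hX
      have hY : Y ≠ 0 := by
        rintro rfl
        apply hb
        linear_combination -h
      refine ⟨(1 + a⁻¹) / 2, (1 - a⁻¹) / 2 / Y, ?_⟩
      field_simp
      linear_combination -(a - 1) ^ 2 * h
    · refine ⟨Y / X, 1 / X, ?_⟩
      field_simp
      linear_combination -h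
  · rintro ⟨x, y, h⟩
    by_cases hy : y = 0
    · subst hy
      have hx : x ≠ 0 := by
        rintro rfl
        simp at h
      refine ⟨(1 + b) / 2, x * (1 - b) / 2, ?_⟩
      field_simp
      linear_combination -(b - 1) ^ 2 * h
    · refine ⟨1 / y, x / y, ?_⟩
      field_simp
      linear_combination -h

/-- **Discharge** of the named fact `QuaternionAlgebra.nonempty_algEquiv_matrix_iff_hilbertSymbol_eq_one`
(O'Meara 57:9, (1) ⇔ (5); Vignéras I Cor. 2.4): for `a b ≠ 0` in a field with `2 ≠ 0`,
`ℍ[F,a,b] ≃ₐ[F] M₂(F)` iff `(a, b)_F = 1` — from the proved splitting criterion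
`Literature.NumberTheory.Automorphic.QuaternionAlgebra.nonempty_algEquiv_matrix_iff` (`ℍ[F,a,b] ≃ M₂(F)` iff
`X² - aY² = b` is soluble) and `exists_sq_sub_mul_sq_iff_hilbertSymbol_eq_one`.
[cite: Omeara1963, §57 Prop. 57:9] -/
theorem QuaternionAlgebra.nonempty_algEquiv_matrix_iff_hilbertSymbol_eq_one_holds
    (F : Type*) [Field F] (a b : F) :
    QuaternionAlgebra.nonempty_algEquiv_matrix_iff_hilbertSymbol_eq_one F a b := by
  intro _ ha hb
  rw [Literature.NumberTheory.Automorphic.QuaternionAlgebra.nonempty_algEquiv_matrix_iff ha hb]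
  exact exists_sq_sub_mul_sq_iff_hilbertSymbol_eq_one ha hb

end Literature.NumberTheory.QuadraticForms
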